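import Summits.BirchSwinnertonDyer.Rank1Residual.X11b.Three.CornerShapeGammaSerre
import HarnessLib

/-!
# Class X11b at `p = 3`, the non-surjective CORNER: no Kodaira `II`/`II*` away from `2` either —
# so every additive place over `ℓ ≥ 5` is `III`, `III*` or `Iₙ*` (team N8/O2 = cell `b2b-bsdres`,
# sub-target S14♯, seat x11b3-p6)

HONEST FRAMING (verbatim, cell `b2b-bsdres`): the cell deletes the COMBINATION-SHAPED residual
classes for ALL analytic-rank `≤ 1` curves over `ℚ` from PUBLISHED theorems only and TYPES the
construction-shaped ones; this is not "finishing BSD". Team N8/O2 (X11b at `3`; O2 OPEN). Research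
route; nothing booked; NO label changes; the corner `ClassX11b W 3 ∧ ¬ Surj W 3` has no TRUE-OPEN
cell, so nothing here moves a count — it sharpens the ∀-`N` anatomy of CLASS RECORD v4.2 and turns
the EVIDENCE line of `cells/x11b3/CORNER-CENSUS.md` §2.3′ ("at odd additive `ℓ` only
`III / III* / I₀* / Iₙ*`; `II` ×14, `II*` ×9 all over `2`; 484 additive primes, 0 exceptions") into
a theorem CONDITIONAL on the one published fact already used by S14. THEOREMS ONLY (no definition,
no new named fact, no `sorry`).

S14 (`CornerShapeGamma{,Serre}.lean`): on the corner every place of type `IV`/`IV*` lies over `2`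
(Serre: the inertia group of `ℚ_ℓ(E[3])/ℚ_ℓ` at a potentially good `ℓ ≥ 5` has order
`12/gcd(12, ord_ℓ Δ_min)`, `= 3` for `IV`/`IV*`, while on the corner `3 ∤ #ρ̄_{E,3}(Γ_ℚ)`). The SAME
argument excludes `II`/`II*`: `ord_ℓ Δ_min = 2`, resp. `10` (Ogg, residue characteristic `≠ 2, 3`),
Serre's order is `6`, again divisible by `3`. New input: `II`/`II*` are POTENTIALLY GOOD, from
Tate's algorithm as S14 did for `IV`/`IV*`:
* `WeierstrassCurve.valuation_j_le_one_of_c₄_mem_pow` — S14's core stated once for all types: an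
  `O_v`-model `D • M` of the integral local minimal model with `c₄ ∈ 𝔪^k` and `ord_v Δ_min ≤ 3k`
  gives `v(j) ≥ 0` (`j · Δ = c₄³`); any Dedekind domain, any residue characteristic;
* `c₄_mem_of_b₂_mem` (Step-2/3 model of `II`: `b₂, a₃, a₄ ∈ 𝔪 ⇒ c₄ ∈ 𝔪`),
  `c₄_mem_pow_four_of_normalForm_IIstar` (Step-10 model: `c₄ ∈ 𝔪⁴`),
  `valuation_j_le_one_of_kodairaSymbolAt_II_or_IIstar` (residue characteristic `≠ 2, 3`);
* `Three.primesEquiv_eq_two_of_not_surj_of_kodairaSymbolAt_II_or_IIstar` (per-pair `hF`, as S14)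
  and `…_of_serre` (CONDITIONAL on `Serre1972.inertiaOrder_dvd_card_range_galoisRepTorsion` =
  Serre 1972 §5.6 via Martin–Watkins 2006 §3.1–3.2, tree fact p254058): **on the corner every place
  of type `II`/`II*` lies over `2`**;
* `Three.kodairaSymbolAt_eq_III_or_IIIstar_or_Istar_of_not_surj[_of_serre]` — THE ANATOMY: on the
  corner, at every ADDITIVE place not over `2`, the Kodaira type is `III`, `III*` or `Iₙ*`.

References: J.-P. Serre, Invent. Math. 15 (1972) §5.6; G. Martin, M. Watkins, ANTS VII (LNCS 4076,
2006) §3.1–3.2; J. Silverman, *ATAEC* IV.9.4 Steps 3, 10, Table 4.1; `cells/x11b3/CORNER-CENSUS.md`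
§2.3′, `OWNERS.md` (S14, S14♯).
-/

noncomputable section

open scoped Classical NumberField

open WeierstrassCurve NumberField IsDedekindDomain Literature.NumberTheory.EllipticCurves
  Rat.HeightOneSpectrum
  Literature.NumberTheory.DiophantineGeometry
  Literature.NumberTheory.DiophantineGeometry.TateAlgorithm
  Literature.NumberTheory.EllipticCurves.Rank1Residual
open IsDiscreteValuationRing hiding maximalIdeal

/-! ### Kodaira `II` / `II*` is potentially good: `j` is integral (any Dedekind domain) -/

namespace WeierstrassCurve

section Local

variable {A : Type*} [CommRing A] [IsDedekindDomain A] {K : Type*} [Field K]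
  [Algebra A K] [IsFractionRing A K] (v : HeightOneSpectrum A) (W : WeierstrassCurve K)

/-- Kodaira type `II` or `II*` is an ADDITIVE type. [folklore] -/
theorem isAdditive_of_eq_II_or_IIstar {k : KodairaSymbol} (hk : k = .II ∨ k = .IIstar) :
    k.IsAdditive := by
  refine ⟨fun hg => ?_, fun ⟨n, _, hn⟩ => ?_⟩
  · rcases hk with hk | hk <;> rw [hk] at hg <;> exact KodairaSymbol.noConfusion hg
  · rcases hk with hk | hk <;> rw [hk] at hn <;> exact KodairaSymbol.noConfusion hn

/-- **The Step-2 model of an additive type puts `c₄` in `𝔪`.** For an `R`-model `J` with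
`b₂, a₃, a₄ ∈ I`: `b₄ = 2a₄ + a₁a₃ ∈ I`, so `c₄ = b₂² − 24 b₄ ∈ I`.
[cite: SilvermanATAEC1994, IV.9.4 Steps 2–3 (PDF p. 344) and III.1 (b₂, b₄, c₄)] -/
theorem c₄_mem_of_b₂_mem {R : Type*} [CommRing R] (I : Ideal R) (J : WeierstrassCurve R)
    (h2 : J.b₂ ∈ I) (h3 : J.a₃ ∈ I) (h4 : J.a₄ ∈ I) : J.c₄ ∈ I ^ 1 := by
  have hb₄ : J.b₄ ∈ I := by
    rw [WeierstrassCurve.b₄]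
    exact I.add_mem (I.mul_mem_left _ h4) (I.mul_mem_left _ h3)
  rw [pow_one, WeierstrassCurve.c₄, sq]
  exact I.sub_mem (I.mul_mem_left _ h2) (I.mul_mem_left _ hb₄)

/-- **Tate's normal form of type `II*` puts `c₄` in `𝔪⁴`.** For an `R`-model `J` with `a₁ ∈ I`,
`a₂ ∈ I²`, `a₃ ∈ I³`, `a₄ ∈ I⁴`: `b₂ = a₁² + 4a₂ ∈ I²`, `b₄ = 2a₄ + a₁a₃ ∈ I⁴`, so
`c₄ = b₂² − 24 b₄ ∈ I⁴`. [cite: SilvermanATAEC1994, IV.9.4 Step 10 (PDF p. 346) and III.1 (b₂, b₄, c₄)] -/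
theorem c₄_mem_pow_four_of_normalForm_IIstar {R : Type*} [CommRing R] (I : Ideal R)
    (J : WeierstrassCurve R) (h1 : J.a₁ ∈ I) (h2 : J.a₂ ∈ I ^ 2) (h3 : J.a₃ ∈ I ^ 3)
    (h4 : J.a₄ ∈ I ^ 4) : J.c₄ ∈ I ^ 4 := by
  have hb₂ : J.b₂ ∈ I ^ 2 := by
    rw [WeierstrassCurve.b₂]
    exact Ideal.add_mem _ (Ideal.pow_mem_pow h1 2) (Ideal.mul_mem_left _ _ h2)
  have hb₄ : J.b₄ ∈ I ^ 4 := by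
    rw [WeierstrassCurve.b₄]
    refine Ideal.add_mem _ (Ideal.mul_mem_left _ _ h4) ?_
    show J.a₁ * J.a₃ ∈ I ^ (1 + 3)
    rw [pow_add, pow_one]
    exact Ideal.mul_mem_mul h1 h3
  have hb₂sq : J.b₂ ^ 2 ∈ I ^ 4 := by
    have h := Ideal.pow_mem_pow hb₂ 2
    rwa [← pow_mul] at h
  rw [WeierstrassCurve.c₄]
  exact Ideal.sub_mem _ hb₂sq (Ideal.mul_mem_left _ _ hb₄)

/-- **`c₄ ∈ 𝔪^k` on some `O_v`-model and `ord_v Δ_min ≤ 3k` force `ord_v(j) ≥ 0`** — the core of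
S14's `valuation_j_le_one_of_kodairaSymbolAt_IV_or_IVstar`, for all types: `M` the integral local
minimal model at `v`, `D` over `O_v` with `c₄(D • M) ∈ 𝔪^k`, `ord_v Δ_min ≤ 3k` ⇒ `v.valuation K W.j ≤ 1`
(`j · Δ(D • M) = c₄(D • M)³`, `ord_v Δ(D • M) = ord_v Δ_min`). Any Dedekind domain, any residue
characteristic. [cite: SilvermanATAEC1994, IV.9.4 and Table 4.1 (the column "ord_v(j)")] -/
theorem valuation_j_le_one_of_c₄_mem_pow [W.IsElliptic] (k d : ℕ)
    (hd : W.ordMinimalDiscriminant v = d) (hdk : d ≤ 3 * k)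
    (hnf : ∃ D : VariableChange (v.adicCompletionIntegers K),
      (D • W.localMinimalIntegralModel v).c₄ ∈
        IsLocalRing.maximalIdeal (v.adicCompletionIntegers K) ^ k) :
    v.valuation K W.j ≤ 1 := by
  set O := v.adicCompletionIntegers K with hO
  set M := W.localMinimalIntegralModel v with hM
  have hΔ0 : M.Δ ≠ 0 := localMinimalIntegralModel_Δ_ne_zero v W
  have hϖ : Irreducible (uniformizer O) := irreducible_uniformizer
  obtain ⟨D, hc₄⟩ := hnf
  set J := D • M with hJ
  -- valuations on `K_v`: `Δ(M)`, the unit `D.u⁻¹`, the uniformiser, `c₄(J)`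
  obtain ⟨N, hN, hvΔ⟩ := HeightOneSpectrum.exists_addVal_adicCompletionIntegers_eq K v M.Δ hΔ0
  have hNd : N = d := by
    have h1 : (IsDiscreteValuationRing.addVal O M.Δ).toNat = W.ordMinimalDiscriminant v := rfl
    rw [hN, hd] at h1
    simpa using h1
  rw [hNd] at hvΔ
  have hvu : Valued.v (((D.u⁻¹ : Oˣ) : O) : v.adicCompletion K) = 1 :=
    HeightOneSpectrum.adicCompletionIntegers.isUnit_iff_valued_eq_one.mp (Units.isUnit _)
  obtain ⟨Nπ, hNπ, hvπ⟩ :=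
    HeightOneSpectrum.exists_addVal_adicCompletionIntegers_eq K v (uniformizer O) hϖ.ne_zero
  have hNπ1 : Nπ = 1 := by
    have h1 : IsDiscreteValuationRing.addVal O (uniformizer O) = 1 :=
      IsDiscreteValuationRing.addVal_uniformizer hϖ
    rw [h1] at hNπ
    exact_mod_cast hNπ.symm
  rw [hNπ1] at hvπ
  have hvc₄ : Valued.v ((J.c₄ : O) : v.adicCompletion K) ≤ WithZero.exp (-(k : ℤ)) := by
    obtain ⟨t, ht⟩ := (mem_maximalIdeal_pow_iff_dvd_of_irreducible hϖ _ _).mp hc₄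
    rw [ht]
    push_cast
    rw [map_mul, map_pow, hvπ, ← WithZero.exp_nsmul]
    have htle : Valued.v ((t : O) : v.adicCompletion K) ≤ 1 := t.2
    calc WithZero.exp ((k : ℕ) • (-1 : ℤ)) * Valued.v ((t : O) : v.adicCompletion K)
        ≤ WithZero.exp ((k : ℕ) • (-1 : ℤ)) * 1 := by gcongr
      _ = WithZero.exp (-(k : ℤ)) := by rw [mul_one]; congr 1; simp
  -- `j · Δ(J) = c₄(J)³` in `K_v`, with `Δ(J) = u⁻¹² Δ(M)`
  have hjΔ : ∀ (E : WeierstrassCurve (v.adicCompletion K)) [E.IsElliptic],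
      E.j * E.Δ = E.c₄ ^ 3 := fun E _ ↦ by
    rw [WeierstrassCurve.j, ← coe_Δ', mul_comm, ← mul_assoc, Units.mul_inv, one_mul]
  haveI hXell : (W.baseChange (v.adicCompletion K)).IsElliptic := by
    unfold baseChange; infer_instance
  obtain ⟨C, hC⟩ : ∃ C : VariableChange (v.adicCompletion K),
      C • W.baseChange (v.adicCompletion K) = W.localMinimalModel v := ⟨_, rfl⟩
  have keyM : (W.j : v.adicCompletion K) * ((M.Δ : O) : v.adicCompletion K) =
      ((M.c₄ : O) : v.adicCompletion K) ^ 3 := by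
    have hj' : (C • W.baseChange (v.adicCompletion K)).j = (W.j : v.adicCompletion K) := by
      rw [variableChange_j]; exact W.map_j _
    have hΔ' : ((M.Δ : O) : v.adicCompletion K) = (C • W.baseChange (v.adicCompletion K)).Δ := by
      rw [hC, hM, localMinimalIntegralModel]
      exact integralModel_Δ_eq (v.adicCompletionIntegers K) (W.localMinimalModel v)
    have hc₄' : ((M.c₄ : O) : v.adicCompletion K) =
        (C • W.baseChange (v.adicCompletion K)).c₄ := by
      rw [hC, hM, localMinimalIntegralModel]
      exact integralModel_c₄_eq (v.adicCompletionIntegers K) (W.localMinimalModel v)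
    rw [hΔ', hc₄', ← hj']
    exact hjΔ _
  have key : (W.j : v.adicCompletion K) * ((J.Δ : O) : v.adicCompletion K) =
      ((J.c₄ : O) : v.adicCompletion K) ^ 3 := by
    rw [hJ, variableChange_Δ, variableChange_c₄]
    push_cast
    rw [mul_pow, ← pow_mul, ← keyM]
    ring
  -- read off `v(j) ≤ exp (d - 3k) ≤ 1`
  have hvJΔ : Valued.v (((J.Δ : O)) : v.adicCompletion K) = WithZero.exp (-(d : ℤ)) := by
    rw [hJ, variableChange_Δ]
    push_cast
    rw [map_mul, map_pow, hvu, one_pow, one_mul, hvΔ]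
  have hvj : Valued.v (W.j : v.adicCompletion K) ≤ WithZero.exp ((d : ℤ) - 3 * k) := by
    have h := congrArg Valued.v key
    rw [map_mul, map_pow, hvJΔ] at h
    calc Valued.v (W.j : v.adicCompletion K)
        = Valued.v (W.j : v.adicCompletion K) * WithZero.exp (-(d : ℤ)) * WithZero.exp (d : ℤ) := by
          rw [mul_assoc, ← WithZero.exp_add, neg_add_cancel, WithZero.exp_zero, mul_one]
      _ = Valued.v ((J.c₄ : O) : v.adicCompletion K) ^ 3 * WithZero.exp (d : ℤ) := by rw [h]
      _ ≤ WithZero.exp (-(k : ℤ)) ^ 3 * WithZero.exp (d : ℤ) := by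
          gcongr
          exact zero_le
      _ = WithZero.exp ((d : ℤ) - 3 * k) := by
          rw [← WithZero.exp_nsmul, ← WithZero.exp_add]; congr 1; ring
  rw [← HeightOneSpectrum.valuedAdicCompletion_eq_valuation']
  refine hvj.trans ?_
  rw [← WithZero.exp_zero, WithZero.exp_le_exp]
  omega

/-- **Kodaira type `II` or `II*` at a place of residue characteristic `≠ 2, 3` forces
`ord_v(j) ≥ 0`** (POTENTIALLY GOOD): for `II` the Step-2 translation of the integral local minimal
model (`exists_variableChange_step2_of_perfectField` = `normalizeStep2`) has `a₃, a₄ ∈ 𝔪` and, Step 3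
having fired (`kodairaSymbolOfMinimal_eq_II_imp`), `b₂ ∈ 𝔪`, so `c₄ ∈ 𝔪`; for `II*` Tate's Step-10
model (`exists_smul_of_kodairaSymbolOfMinimal_eq_IIstar`) has `c₄ ∈ 𝔪⁴`; `ord_v Δ_min = m_v + 1 = 2`,
resp. `10` (Ogg); apply `valuation_j_le_one_of_c₄_mem_pow` with `(k, d) = (1, 2)`, `(4, 10)`.
[cite: SilvermanATAEC1994, IV.9.4 Steps 3 and 10, Table 4.1 (PDF pp. 344–346, 365)] -/
theorem valuation_j_le_one_of_kodairaSymbolAt_II_or_IIstar [W.IsElliptic]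
    [PerfectField (IsLocalRing.ResidueField (v.adicCompletionIntegers K))]
    (h2 : ringChar (A ⧸ v.asIdeal) ≠ 2) (h3 : ringChar (A ⧸ v.asIdeal) ≠ 3)
    (hT : W.kodairaSymbolAt v = .II ∨ W.kodairaSymbolAt v = .IIstar) :
    v.valuation K W.j ≤ 1 := by
  set M := W.localMinimalIntegralModel v with hM
  -- additive reduction and `ord_v Δ_min = m_v + 1 ∈ {2, 10}`
  have hadd : W.HasAdditiveReductionAt v :=
    (W.isAdditive_kodairaSymbolAt_iff_holds v).mp (isAdditive_of_eq_II_or_IIstar hT)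
  have hord : W.ordMinimalDiscriminant v = W.numComponentsAt v + 1 :=
    W.ordMinimalDiscriminant_eq_numComponentsAt_add_one_holds v hadd h2 h3
  rw [kodairaSymbolAt_def] at hT
  rcases hT with hT | hT
  · -- type `II`: the Step-2 model has `b₂, a₃, a₄ ∈ 𝔪`
    obtain ⟨hΔ, hb₂, -⟩ := LocalIndex.kodairaSymbolOfMinimal_eq_II_imp M hT
    have hex := exists_variableChange_step2_of_perfectField M hΔ
    obtain ⟨-, hA₃, hA₄, -⟩ := hex.choose_spec
    have hN2 : normalizeStep2 M = hex.choose • M := dif_pos hex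
    rw [hN2] at hb₂
    refine valuation_j_le_one_of_c₄_mem_pow v W 1 2 ?_ (by norm_num)
      ⟨hex.choose, c₄_mem_of_b₂_mem _ _ hb₂ hA₃ hA₄⟩
    rw [hord]; unfold numComponentsAt; rw [kodairaSymbolAt_def, ← hM, hT]; rfl
  · -- type `II*`: the Step-10 model has `a₁ ∈ 𝔪, a₂ ∈ 𝔪², a₃ ∈ 𝔪³, a₄ ∈ 𝔪⁴`
    obtain ⟨D, h1, h2', h3', h4, -, -⟩ :=
      LocalIndex.exists_smul_of_kodairaSymbolOfMinimal_eq_IIstar M hT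
    refine valuation_j_le_one_of_c₄_mem_pow v W 4 10 ?_ (by norm_num)
      ⟨D, c₄_mem_pow_four_of_normalForm_IIstar _ _ h1 h2' h3' h4⟩
    rw [hord]; unfold numComponentsAt; rw [kodairaSymbolAt_def, ← hM, hT]; rfl

/-- **Types `II` and `II*` are ADDITIVE**: at such a place the reduction is neither good nor
multiplicative (Tate's algorithm Steps 1–2 return `I₀`, resp. `Iₙ`; `isGood_kodairaSymbolAt_iff`,
`kodairaSymbolAt_eq_I_iff`). [cite: SilvermanATAEC1994, IV.9.4 Steps 1–2 (PDF p. 344)] -/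
theorem not_good_not_mult_of_kodairaSymbolAt_II [W.IsElliptic] [Finite (A ⧸ v.asIdeal)]
    (hk : W.kodairaSymbolAt v = .II ∨ W.kodairaSymbolAt v = .IIstar) :
    ¬ W.HasGoodReductionAt v ∧ ¬ W.HasMultiplicativeReductionAt v := by
  haveI : Finite (IsLocalRing.ResidueField (v.adicCompletionIntegers K)) :=
    HeightOneSpectrum.finite_residueField_adicCompletionIntegers K v
  haveI : PerfectField (IsLocalRing.ResidueField (v.adicCompletionIntegers K)) :=
    PerfectField.ofFinite
  refine ⟨fun hg => ?_, fun hm => ?_⟩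
  · have h0 : W.kodairaSymbolAt v = .I 0 :=
      (WeierstrassCurve.isGood_kodairaSymbolAt_iff_holds v W).mpr hg
    rcases hk with hk | hk <;> rw [hk] at h0 <;> exact KodairaSymbol.noConfusion h0
  · have hn : W.ordMinimalDiscriminant v ≠ 0 :=
      (Summit.BirchSwinnertonDyer.Rank1Residual.X11b.ordMinimalDiscriminant_pos_of_hasMultiplicativeReductionAt
        v W hm).ne'
    have hI : W.kodairaSymbolAt v = .I (W.ordMinimalDiscriminant v) :=
      (WeierstrassCurve.kodairaSymbolAt_eq_I_iff_holds v W hn).mpr ⟨hm, rfl⟩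
    rcases hk with hk | hk <;> rw [hk] at hI <;> exact KodairaSymbol.noConfusion hI

end Local

end WeierstrassCurve

/-! ### The corner of X11b@3: no `II`/`II*` away from `2`; the additive anatomy over `ℓ ≠ 2` -/

namespace Summit.BirchSwinnertonDyer.Rank1Residual.X11b.Three

variable (W : WeierstrassCurve ℚ) [W.IsElliptic]

/-- **A place of type `II`/`II*` of an X11b@3 pair lies over a prime `ℓ ≠ 3`**: the reduction at the
place over `3` is multiplicative (`3 ∥ N`), hence of type `Iₙ`, never additive. [folklore] -/
theorem primesEquiv_ne_three_of_typeII [Fact (Nat.Prime 3)] (hX : ClassX11b W 3)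
    {v : HeightOneSpectrum (𝓞 ℚ)} (hk : W.kodairaSymbolAt v = .II ∨ W.kodairaSymbolAt v = .IIstar) :
    (primesEquiv v : ℕ) ≠ 3 := by
  intro h3
  have hmult3 : Mult W 3 := hX.2.2.1
  have key : ∀ (q : ℕ) (hq : Fact q.Prime), q = 3 →
      @WeierstrassCurve.HasMultiplicativeReductionAtPrime W q hq := by
    rintro q hq rfl; exact hmult3
  have hmult : W.HasMultiplicativeReductionAt v :=
    (W.hasMultiplicativeReductionAtPrime_iff_hasMultiplicativeReductionAt_ringOfIntegers v).mp
      (key _ _ h3)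
  exact (W.not_good_not_mult_of_kodairaSymbolAt_II v hk).2 hmult

/-- **S14♯: on the corner of X11b@3 every place of Kodaira type `II` or `II*` lies over `2`**
(granted Serre's inertia order at the potentially good places `v ∣ ℓ ≥ 5` of `E`, hypothesis `hF` —
exactly S14's hypothesis; Serre 1972 §5.6 via Martin–Watkins 2006 §3.2, tree fact
`Serre1972.inertiaOrder_dvd_card_range_galoisRepTorsion`). For such a place `v ∣ ℓ`: `ℓ ≠ 3`
(multiplicative at `3`); if `ℓ ≠ 2` then `ℓ ≥ 5`, the residue characteristic is `≠ 2, 3`, `j` is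
`v`-integral (`valuation_j_le_one_of_kodairaSymbolAt_II_or_IIstar`) and `ord_v Δ_min = 2` or `10`,
so `hF` gives `12/gcd(12,2) = 12/gcd(12,10) = 6 ∣ #ρ̄_{E,3}(Γ_ℚ)`, hence `3 ∣ #ρ̄_{E,3}(Γ_ℚ)`,
contradicting `not_three_dvd_card_range_galoisRepTorsion_of_not_surj`. CONDITIONAL on `hF`;
nothing booked; no TRUE-OPEN cell on the corner. [cite: MartinWatkins2006, §3.2]
[cite: Serre1972, §5.6 (p. 312) and §2.4 Prop. 15] [cite: SilvermanATAEC1994, IV.9.4 Steps 3 and 10, Table 4.1] -/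
theorem primesEquiv_eq_two_of_not_surj_of_kodairaSymbolAt_II_or_IIstar [Fact (Nat.Prime 3)]
    (hF : ∀ v : HeightOneSpectrum (𝓞 ℚ), 5 ≤ (primesEquiv v : ℕ) → v.valuation ℚ W.j ≤ 1 →
      12 / Nat.gcd 12 (W.ordMinimalDiscriminant v) ∣ Nat.card (galoisRepTorsion W (3 : ℕ)).range)
    (hX : ClassX11b W 3) (hns : ¬ Surj W 3) {v : HeightOneSpectrum (𝓞 ℚ)}
    (hk : W.kodairaSymbolAt v = .II ∨ W.kodairaSymbolAt v = .IIstar) :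
    (primesEquiv v : ℕ) = 2 := by
  by_contra h2
  have hℓ : (primesEquiv v : ℕ).Prime := (primesEquiv v).2
  have h3 : (primesEquiv v : ℕ) ≠ 3 := primesEquiv_ne_three_of_typeII W hX hk
  have h5 : 5 ≤ (primesEquiv v : ℕ) := by
    by_contra hlt
    have := hℓ.two_le
    interval_cases h : (primesEquiv v : ℕ) <;> first | exact absurd hℓ (by decide) | omega
  have hc := X2.ringChar_quot_asIdeal_eq_primesEquiv v
  have hc2 : ringChar (𝓞 ℚ ⧸ v.asIdeal) ≠ 2 := by rw [hc]; exact h2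
  have hc3 : ringChar (𝓞 ℚ ⧸ v.asIdeal) ≠ 3 := by rw [hc]; exact h3
  haveI : Finite (IsLocalRing.ResidueField (v.adicCompletionIntegers ℚ)) :=
    HeightOneSpectrum.finite_residueField_adicCompletionIntegers ℚ v
  haveI : PerfectField (IsLocalRing.ResidueField (v.adicCompletionIntegers ℚ)) :=
    PerfectField.ofFinite
  have hj : v.valuation ℚ W.j ≤ 1 :=
    W.valuation_j_le_one_of_kodairaSymbolAt_II_or_IIstar v hc2 hc3 hk
  -- `ord_v Δ_min ∈ {2, 10}`, so Serre's inertia order is `6`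
  have hadd : W.HasAdditiveReductionAt v :=
    (W.isAdditive_kodairaSymbolAt_iff_holds v).mp (isAdditive_of_eq_II_or_IIstar hk)
  have hord : W.ordMinimalDiscriminant v = W.numComponentsAt v + 1 :=
    W.ordMinimalDiscriminant_eq_numComponentsAt_add_one_holds v hadd hc2 hc3
  have hd : 12 / Nat.gcd 12 (W.ordMinimalDiscriminant v) = 6 := by
    rw [hord]; unfold numComponentsAt
    rcases hk with hk | hk <;> rw [hk] <;> decide
  have hdvd := hF v h5 hj
  rw [hd] at hdvd
  exact not_three_dvd_card_range_galoisRepTorsion_of_not_surj W hX hns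
    (dvd_trans (by norm_num : (3 : ℕ) ∣ 6) hdvd)

/-- **S14♯, binder-list form: on the corner there is NO place of type `II`/`II*` over any `ℓ ≠ 2`**
(granted `hF`). [cite: MartinWatkins2006, §3.2] [cite: Serre1972, §5.6 (p. 312)] -/
theorem not_kodairaSymbolAt_II_or_IIstar_of_not_surj_of_ne_two [Fact (Nat.Prime 3)]
    (hF : ∀ v : HeightOneSpectrum (𝓞 ℚ), 5 ≤ (primesEquiv v : ℕ) → v.valuation ℚ W.j ≤ 1 →
      12 / Nat.gcd 12 (W.ordMinimalDiscriminant v) ∣ Nat.card (galoisRepTorsion W (3 : ℕ)).range)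
    (hX : ClassX11b W 3) (hns : ¬ Surj W 3) {v : HeightOneSpectrum (𝓞 ℚ)}
    (hv : (primesEquiv v : ℕ) ≠ 2) :
    ¬ (W.kodairaSymbolAt v = .II ∨ W.kodairaSymbolAt v = .IIstar) := fun hk ↦
  hv (primesEquiv_eq_two_of_not_surj_of_kodairaSymbolAt_II_or_IIstar W hF hX hns hk)

/-- **S14 ∧ S14♯, THE ADDITIVE ANATOMY OF THE CORNER (granted `hF`): at an ADDITIVE place `v` of a
corner pair not over `2`, the Kodaira type is `III`, `III*` or `Iₙ*`** (`n ≥ 0`) — the potentially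
good types whose Serre inertia order `12/gcd(12, ord_v Δ_min)` is divisible by `3`, namely
`II` (`6`), `IV` (`3`), `IV*` (`3`), `II*` (`6`), cannot occur when `3 ∤ #ρ̄_{E,3}(Γ_ℚ)`. This is
the kernel form of `cells/x11b3/CORNER-CENSUS.md` §2.3′ (EVIDENCE there: over the 484 additive
primes of the 296 corner class-pairs, at odd `ℓ` only `III / III* / I₀* / I₃* / I₆*` occur).
CONDITIONAL on `hF`; nothing booked. [cite: MartinWatkins2006, §3.2] [cite: Serre1972, §5.6 (p. 312)]
[cite: SilvermanATAEC1994, IV.9.4 Table 4.1] -/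
theorem kodairaSymbolAt_eq_III_or_IIIstar_or_Istar_of_not_surj [Fact (Nat.Prime 3)]
    (hF : ∀ v : HeightOneSpectrum (𝓞 ℚ), 5 ≤ (primesEquiv v : ℕ) → v.valuation ℚ W.j ≤ 1 →
      12 / Nat.gcd 12 (W.ordMinimalDiscriminant v) ∣ Nat.card (galoisRepTorsion W (3 : ℕ)).range)
    (hX : ClassX11b W 3) (hns : ¬ Surj W 3) {v : HeightOneSpectrum (𝓞 ℚ)}
    (hv : (primesEquiv v : ℕ) ≠ 2) (hadd : W.HasAdditiveReductionAt v) :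
    W.kodairaSymbolAt v = .III ∨ W.kodairaSymbolAt v = .IIIstar ∨
      ∃ n : ℕ, W.kodairaSymbolAt v = .Istar n := by
  have hA : (W.kodairaSymbolAt v).IsAdditive := (W.isAdditive_kodairaSymbolAt_iff_holds v).mpr hadd
  have hII := not_kodairaSymbolAt_II_or_IIstar_of_not_surj_of_ne_two W hF hX hns hv
  have hIV := not_kodairaSymbolAt_IV_or_IVstar_of_not_surj_of_ne_two W hF hX hns hv
  rcases hs : W.kodairaSymbolAt v with n | _ | _ | _ | n | _ | _ | _
  · -- `Iₙ` is not additive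
    exfalso
    rcases Nat.eq_zero_or_pos n with rfl | hn
    · exact hA.1 (by rw [hs]; rfl)
    · exact hA.2 ⟨n, hn.ne', by rw [hs]⟩
  · exact absurd (Or.inl hs) hII
  · exact Or.inl rfl
  · exact absurd (Or.inl hs) hIV
  · exact Or.inr (Or.inr ⟨n, rfl⟩)
  · exact absurd (Or.inr hs) hIV
  · exact Or.inr (Or.inl rfl)
  · exact absurd (Or.inr hs) hII

/-! ### Named-fact forms (CONDITIONAL on Serre 1972 §5.6 = the tree fact of S14) -/

/-- **S14♯ with the named fact: on the corner of X11b@3 every place of Kodaira type `II` or `II*`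
lies over `2`** (`ClassX11b W 3`, `¬ Surj W 3`; CONDITIONAL on
`Serre1972.inertiaOrder_dvd_card_range_galoisRepTorsion`). [cite: MartinWatkins2006, §3.2] [cite: Serre1972, §5.6 (p. 312) and §2.4 Prop. 15] -/
theorem primesEquiv_eq_two_of_not_surj_of_kodairaSymbolAt_II_or_IIstar_of_serre [Fact (Nat.Prime 3)]
    (hS : Serre1972.inertiaOrder_dvd_card_range_galoisRepTorsion)
    (hX : ClassX11b W 3) (hns : ¬ Surj W 3) {v : HeightOneSpectrum (𝓞 ℚ)}
    (hk : W.kodairaSymbolAt v = .II ∨ W.kodairaSymbolAt v = .IIstar) :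
    (primesEquiv v : ℕ) = 2 :=
  primesEquiv_eq_two_of_not_surj_of_kodairaSymbolAt_II_or_IIstar W (serre_hF_three W hS) hX hns hk

/-- **S14♯, binder-list form with the named fact: on the corner there is NO place of type `II`/`II*`
over any `ℓ ≠ 2`.** [cite: MartinWatkins2006, §3.2] [cite: Serre1972, §5.6 (p. 312)] -/
theorem not_kodairaSymbolAt_II_or_IIstar_of_not_surj_of_ne_two_of_serre [Fact (Nat.Prime 3)]
    (hS : Serre1972.inertiaOrder_dvd_card_range_galoisRepTorsion)
    (hX : ClassX11b W 3) (hns : ¬ Surj W 3) {v : HeightOneSpectrum (𝓞 ℚ)}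
    (hv : (primesEquiv v : ℕ) ≠ 2) :
    ¬ (W.kodairaSymbolAt v = .II ∨ W.kodairaSymbolAt v = .IIstar) :=
  not_kodairaSymbolAt_II_or_IIstar_of_not_surj_of_ne_two W (serre_hF_three W hS) hX hns hv

/-- **THE ADDITIVE ANATOMY OF THE CORNER with the named fact: at an additive place `v ∤ 2` of a pair
with `ClassX11b W 3 ∧ ¬ Surj W 3`, the Kodaira type is `III`, `III*` or `Iₙ*`** (CONDITIONAL on
Serre 1972 §5.6 = `Serre1972.inertiaOrder_dvd_card_range_galoisRepTorsion`; kernel form of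
CORNER-CENSUS §2.3′; nothing booked). [cite: MartinWatkins2006, §3.2] [cite: Serre1972, §5.6 (p. 312)]
[cite: SilvermanATAEC1994, IV.9.4 Table 4.1] -/
theorem kodairaSymbolAt_eq_III_or_IIIstar_or_Istar_of_not_surj_of_serre [Fact (Nat.Prime 3)]
    (hS : Serre1972.inertiaOrder_dvd_card_range_galoisRepTorsion)
    (hX : ClassX11b W 3) (hns : ¬ Surj W 3) {v : HeightOneSpectrum (𝓞 ℚ)}
    (hv : (primesEquiv v : ℕ) ≠ 2) (hadd : W.HasAdditiveReductionAt v) :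
    W.kodairaSymbolAt v = .III ∨ W.kodairaSymbolAt v = .IIIstar ∨
      ∃ n : ℕ, W.kodairaSymbolAt v = .Istar n :=
  kodairaSymbolAt_eq_III_or_IIIstar_or_Istar_of_not_surj W (serre_hF_three W hS) hX hns hv hadd

end Summit.BirchSwinnertonDyer.Rank1Residual.X11b.Three

end
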